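import Summits.MatrixMultiplication.MatrixMultiplication.Theorems.AbelianSTPPCensusShapeCertVQKDefs
import Summits.MatrixMultiplication.MatrixMultiplication.Theorems.AbelianSTPPCensusTAStatQNode

/-!
# Abelian STPP census — the vQK certificate checker with the U11-G′ NODE KILL, `ShapeCertVQ.checkQKG` (vQKG := vP ∧ E3⁺ ∧ E3K ∧ U11-G′): definitions

Cell mm-stpp, rung F-M1; census-silent kernel ENABLER for the tranche-2 device band on `T_E` (orders `≥ 477`, where the instrument
vQK := vP ∧ E3⁺ ∧ E3K is no longer exclusionary: `AbelianSTPPCensusVP.vqkCensusTE_false_above_477`, the list `(8,6,6)⁴ + (5,4,3)`),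
filed in support of the closed crux item stmt-MatrixMultiplication-19191; seat mm-stpp-vp-p2 (gen 9).  PRE-REG v1 band B3 put the rule
U11-G′ in the tree (`U11GPrimeFormB` / `U11GPrime`, `AbelianSTPPCensusU11GPrime.lean`, seat mm-stpp-theory gen 13: Grynkiewicz's rule U11-G
with the Grynkiewicz–Wang 2026 floor `⌊(4t² − 2t)/3⌋` in place of `2t² − 1` and the guard `t ≥ 2` in place of `t ≥ 3`; it kills the
vQK-alive lists of record at `477 / 478 / 480`, `U11GPrimeWall.*`).  This file is vp-p2 g3's `ShapeCertVQ.checkQK` (`…ShapeCertVQKDefs`)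
with ONE more node test, exactly as `checkQK` was g2's `checkQS` with the E3K kill added:

* the **U11-type node kill under a GENERAL budget constant** `killGB bud t0 vtx` — the credit-form kill of `ShapeCertVP.killV`
  (`killAt`: `(r,t)` admissible and `t·Σ(ab+bc+ca) > t·M + (2t² − 1) + Σ cr_t`) with the constant `2t² − 1` replaced by a parameter
  `bud t`, the guard `3 ≤ t` by `t0 ≤ t`, and the vertex guess `(U − M)/4` of the candidate `t` by `vtx (U − M)` (`admRTB`, `killAtB`,
  `killFormB`; the same bookkeeping `P1Of / P2Of / fibL / crS / uuA / mxMid` of `ShapeCertVP`, the same four candidates `lo, hi, v, v+1`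
  per letter form, prefilter `M < U` only).  Like `killV` it is hereditary (a killed prefix kills all its completions), so it is a sound
  node test under the credit form `AdmGB bud t0` of the rule (`…ShapeCertVQKGSemantics`);
* its **U11-G′ instantiation** `killGW := killGB TAStatQ.gwC 2 vtxGW` (`TAStatQ.gwC t = ⌊(4t² − 2t)/3⌋`, vp-p2 g8's `…TAStatQNode`, by
  name; `vtxGW e = ⌊(3e + 2)/8⌋`, the maximiser of `t·e − (4t² − 2t)/3`), and the node kill `killEKG := killEK ∨ killGW`;
* the search `dfsKG` / checker `checkQKG` / node-level decision `nodeDecKG` / path segments `pathOutKG`, `pathInKG` / assembly target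
  `PathOKKG` — VERBATIM `dfsK` / `checkQK` / `nodeDecK` / `pathOutK` / `pathInK` / `PathOKK` with `killEKG` for `killEK` (the candidate
  step, the walks, their segments and the path nodes are g2's `stepS` / `innerS` / `loopS` / `segOutS` / `segInS` / `nodeOutS` / `nodeInS` /
  `pathNodeS`, reused by name; the Grynkiewicz BUDGETS and continuation bounds of the walk stay the trio's `budRT` — sound a fortiori,
  `u11G_of_u11GPrime`).
Soundness: `…ShapeCertVQKG{Semantics,Search,SearchP}`; bridge to `SieveAdmissibleVP ∧ E3pAdm ∧ E3kAdm ∧ U11GPrime → ¬ Beats (5/2)` at an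
order `M ≤ 489` (the static universe `ShapeCertVQ.Mtop` of the vQ data): `…ShapeCertVQKGFinal`.  Validation probe (instrument): `…VQKGProbe477`.
WHAT THIS IS NOT: no statement about STPP families or `ω` by itself; no census number, no order range, no band, no kit job; nothing about
orders `> 489` (a wider static universe is table-side work); no new rule (U11-G′ is theory g13's `u11GPrimeSound`) — one more sound node
test inside the same search.
-/

set_option linter.dupNamespace false -- `MatrixMultiplication.MatrixMultiplication` (summit = problem, D-0017)
set_option autoImplicit false

namespace Summit.MatrixMultiplication.MatrixMultiplication.Theorems.ShapeCertVQ

open ShapeCert ShapeCertVP STPPThreeRoomEnergy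

/-! ### The U11-type node kill under a general budget constant `bud` with guard `t0` -/

/-- `(r, t)` is admissible for the prefix with guard `t0`: `t0 ≤ t ≤ min(P₁, P₂)` and `t ≤ L_r(t)` (`ShapeCertVP.admRT` has `t0 = 3`). -/
def admRTB (t0 r t : ℕ) (A : Agg) (f : List Sh) : Bool :=
  decide (t0 ≤ t) && decide (t ≤ P1Of r A) && decide (t ≤ P2Of r A) && decide (t ≤ fibL r t f)

/-- Kill of the prefix `f` (aggregates `A`) in form `r` at `t` under the budget constant `bud`: admissible and
`t·Σ(ab+bc+ca) > t·M + bud t + Σ cr_t` (`ShapeCertVP.killAt` has `bud t = 2t² − 1`). -/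
def killAtB (bud : ℕ → ℕ) (t0 M r t : ℕ) (A : Agg) (f : List Sh) : Bool :=
  admRTB t0 r t A f && decide (t * M + bud t + crS r t f < t * uuA A)

/-- Kill test in form `r`: the exact test at the four candidates `max lo t0, hi, v, v + 1` of the last segment (`lo` = one above the largest
middle letter, `hi = min(P₁, P₂, L_r(lo))`, `v = vtx (U − M)` the vertex guess; as `ShapeCertVP.killForm`). -/
def killFormB (bud : ℕ → ℕ) (t0 : ℕ) (vtx : ℕ → ℕ) (M r : ℕ) (A : Agg) (f : List Sh) : Bool :=
  seqN (mxMid r f + 1) fun lo => seqN (min (P1Of r A) (min (P2Of r A) (fibL r lo f))) fun hi =>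
  seqN (vtx (uuA A - M)) fun v =>
    killAtB bud t0 M r (max lo t0) A f || killAtB bud t0 M r hi A f || killAtB bud t0 M r v A f ||
      killAtB bud t0 M r (v + 1) A f

/-- The U11-type node kill of a prefix under `bud` / `t0` / `vtx` (three letter forms), gated by `U > M`. -/
def killGB (bud : ℕ → ℕ) (t0 : ℕ) (vtx : ℕ → ℕ) (M : ℕ) (A : Agg) (f : List Sh) : Bool :=
  seqN (uuA A) fun U =>
    decide (M < U) && (killFormB bud t0 vtx M 0 A f || killFormB bud t0 vtx M 1 A f || killFormB bud t0 vtx M 2 A f)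

/-! ### The U11-G′ instantiation -/

/-- Vertex guess for the Grynkiewicz–Wang constant: `⌊(3e + 2)/8⌋` maximises `t·e − (4t² − 2t)/3` over the reals. -/
def vtxGW (e : ℕ) : ℕ := (3 * e + 2) / 8

/-- **The U11-G′ node kill**: `killGB` at `bud = TAStatQ.gwC` (`⌊(4t² − 2t)/3⌋`), `t0 = 2`, vertex guess `vtxGW`. -/
def killGW (M : ℕ) (A : Agg) (f : List Sh) : Bool := killGB TAStatQ.gwC 2 vtxGW M A f

/-- The node kill of `checkQKG`: the node kill `killEK` of `checkQK` (E3⁺ or E3K) or the U11-G′ kill. -/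
def killEKG (ds : List ℕ) (M : ℕ) (A : Agg) (fam : List Sh) : Bool := killEK ds M A fam || killGW M A fam

/-! ### The search (node logic of `dfsK` with `killEKG` for `killEK`; step and walks are `stepS` / `innerS` / `loopS`) -/

/-- The DFS with fuel: `dfsK` with the node kill `killEKG`. -/
def dfsKG (M : ℕ) (ds : List ℕ) : ℕ → List Sh → List (List Sh) → Bool
  | 0, _, _ => false
  | n + 1, fam, B =>
    (aggOf M fam).force fun A =>
      if killEKG ds M A fam then true
      else if M * D < A.gs then false
      else if A.dead M then true
      else
        let Bs := budsOf M A fam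
        if Bs.tailEmpty then decide (A.gs ≤ M * D)
        else
          let S := gnodeQ (headLevQ fam) Bs
          seqN S.bud fun gB => seqN S.idx fun gi =>
            if S.ok && decide (A.gs * K + gB * (tabGQ (headLevQ fam)).get gi ≤ M * D * K) then true
            else
              seqN (A.ra M) fun ra => seqN (A.rb M) fun rb => seqN (A.rc M) fun rc => seqN (A.vl M) fun vl =>
              seqN (A.gs * K) fun g0 => seqN (qOfS M A fam) fun q => seqN (A.kOf M) fun k =>
              seqN (M * D * K) fun mdk =>
              seqN (breakLevQ g0 q (selOf k) mdk S.ok gB gi) fun lb1 => seqN (lcapS q vl) fun lc =>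
                let cl := fam.isEmpty || decide (g0 + selOf k (tabRQ loLev) * q ≤ mdk) || clAnyQ Bs g0 mdk loLev
                loopS M (dfsKG M ds n) fam A ra rb rc vl g0 q (selOf k) mdk lb1 lc cl B

/-- The vQKG certificate checker `checkQKG` at order `M` (`M ≤ Mtop = 489`): the divisor list of `M` evaluated once, then the search. -/
def checkQKG (M : ℕ) : Bool := seqL (divsQ M) fun ds => dfsKG M ds (M + 2) [] (candBQ M)

/-! ### Path segments (as `…VQKDefs`, with the node-level decision `nodeDecKG` and the continuation `dfsKG`) -/

/-- The node-level decision of `dfsKG` at a prefix: `some b` if the node is decided without walking its candidates (E3⁺/E3K/U11-G′ kill,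
beating prefix, dead prefix, exhausted or closing Grynkiewicz budget), `none` if the walk is needed. -/
def nodeDecKG (M : ℕ) (ds : List ℕ) (fam : List Sh) : Option Bool :=
  (aggOf M fam).force fun A =>
    if killEKG ds M A fam then some true
    else if M * D < A.gs then some false
    else if A.dead M then some true
    else
      let Bs := budsOf M A fam
      if Bs.tailEmpty then some (decide (A.gs ≤ M * D))
      else
        let S := gnodeQ (headLevQ fam) Bs
        seqN S.bud fun gB => seqN S.idx fun gi =>
          if S.ok && decide (A.gs * K + gB * (tabGQ (headLevQ fam)).get gi ≤ M * D * K) then some true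
          else none

/-- Outer path segment of `checkQKG`: at the node of `path` (depth `d`, continuation `dfsKG M ds (M + 1 − d)`), the node-level decision,
else the walk of the pool's blocks `i … i + n − 1` (divisor list evaluated once). -/
def pathOutKG (M : ℕ) (path : List (ℕ × ℕ)) (i n : ℕ) : Bool :=
  seqL (divsQ M) fun ds =>
    match nodeDecKG M ds (pathNodeS M path).1 with
    | some v => v
    | none => nodeOutS M (dfsKG M ds (M + 1 - path.length)) (pathNodeS M path).1 n (((pathNodeS M path).2).drop i)

/-- Inner path segment of `checkQKG`: at the node of `path`, the node-level decision, else the walk of the members `j … j + n − 1` of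
block `i` of the pool. -/
def pathInKG (M : ℕ) (path : List (ℕ × ℕ)) (i j n : ℕ) : Bool :=
  seqL (divsQ M) fun ds =>
    match nodeDecKG M ds (pathNodeS M path).1 with
    | some v => v
    | none =>
      match ((pathNodeS M path).2).drop i with
      | [] => true
      | b :: bs => nodeInS M (dfsKG M ds (M + 1 - path.length)) (pathNodeS M path).1 bs n (b.drop j)

/-- What the pieces of a node assemble to: the search `dfsKG` accepts the node of `path` (with the fuel of `checkQKG`). [bookkeeping] -/
def PathOKKG (M : ℕ) (path : List (ℕ × ℕ)) : Prop :=
  dfsKG M (divsQ M) (M + 2 - path.length) (pathNodeS M path).1 (pathNodeS M path).2 = true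

end Summit.MatrixMultiplication.MatrixMultiplication.Theorems.ShapeCertVQ
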